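import Mathlib
import Literature.AlgebraicGeometry.Resolution.CobordantGame
import Literature.AlgebraicGeometry.Resolution.CobordantArcLemma
import Literature.AlgebraicGeometry.Resolution.FormalCoordinateChange
import Summits.ResolutionOfSingularities.ResolutionOfSingularities.Theorems.WeightedInvariantLocalWeightedDropGradedSliceRank
import Summits.ResolutionOfSingularities.ResolutionOfSingularities.Theorems.WeightedInvariantLocalWeightedDropGradedGamePropagate

/-!
# `WeightedInvariant.LocalWeightedDrop`: GRADED WINS ARE INVARIANT UNDER GRADED COORDINATE CHANGES — the third transfer of
# the graded game

Route `ResolutionOfSingularities/WeightedInvariant`, crux `LocalWeightedDrop` (stmt-ResolutionOfSingularities-8899).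
[OURS · L1 W4.3] — CHAIN w43 SEAT TABLE v7 row res-type-060 «idea-1's graded slices»; third of the three transfers through which
the surviving ONE-SIDED slice statement («slice graded-won ⇒ successor graded-won», tame case) factors: cylinder
(`…GradedGameCylinder` p511529), unit (`…GradedGameUnit` p512265), graded coordinate change (this file).  With all three in the
kernel, the tame case of the slice statement reduces to EXHIBITING, at a tame exceptional point, the graded coordinate change
`Φ` (with graded inverse) and the unit `u` with `g = u · (cylinder h)(Φ)` — the orbit lemma / `wildSlice_pullback` (p500270)
inverted; not done here.  Nothing here is a statement of the manuscript under review on ladder RESOLUTION; not a verdict on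
card A.  AI proof, weaker than expert review.

* `linMat_comp` — linear parts multiply: `linMat (i ↦ Ψᵢ(θ)) = linMat Ψ · linMat θ` (first-order chain rule
  `CobordantArc.coeff_degree_one_subst`).
* `gradedWonBy_subst_of_leftInverse` — if `Φ` (zero constants) has a GRADED LEFT INVERSE `Ψ` (zero constants, invertible
  linear part, monomials of `Ψᵢ` of the character of `yᵢ`, `Φⱼ(Ψ) = yⱼ`), then `GradedWonBy α m L f → GradedWonBy α m L (f(Φ))`:
  the winning move `(θ, w)` becomes `(i ↦ Ψᵢ(θ), w)`, again `L`-graded (`…GradedGamePropagate.exists_exp_of_coeff_subst_ne_zero`),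
  with `f(Φ)(Ψ(θ)) = f(θ)` on the nose — the SAME successors with the SAME propagated lattices; no induction.
* `gradedWonBy_subst_iff` — with `Φ` graded and `Ψ` a two-sided inverse: `GradedWonBy α m L (f(Φ)) ↔ GradedWonBy α m L f`.
-/

set_option linter.dupNamespace false -- mandated namespace of this single-conjunct summit
set_option autoImplicit false

namespace Summit.ResolutionOfSingularities.ResolutionOfSingularities.Theorems

namespace GradedGame

open MvPowerSeries
open Literature.AlgebraicGeometry.Resolution
open Literature.AlgebraicGeometry.Resolution.CobordantArc (coeff_degree_one_subst)
open Literature.AlgebraicGeometry.Resolution.FormalCoordChange (linMat)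

variable {k : Type} [Field k]

/-- LINEAR PARTS MULTIPLY under composition of zero-constant substitutions: the linear part of `i ↦ Ψᵢ(θ)` is
`linMat Ψ · linMat θ`. [OURS · L1 W4.3] -/
theorem linMat_comp {m : ℕ} (θ Ψ : Fin m → MvPowerSeries (Fin m) k) (hθ0 : ∀ i, constantCoeff (θ i) = 0) :
    linMat (fun i => subst θ (Ψ i)) = linMat Ψ * linMat θ := by
  ext i j
  show coeff (Finsupp.single j 1) (subst θ (Ψ i)) = _
  rw [coeff_degree_one_subst θ hθ0 (Ψ i) (Finsupp.single j 1) (Finsupp.degree_single _ _), Matrix.mul_apply]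
  rfl

/-- **GRADED WINS ARE INVARIANT UNDER GRADED COORDINATE CHANGES, WITH THE SAME RANK.**  Let `Φ` be a zero-constant substitution
with a GRADED LEFT INVERSE `Ψ` (`Ψ` has zero constants, invertible linear part, monomials of `Ψᵢ` of the character of `yᵢ`, and
`Φⱼ(Ψ) = yⱼ`).  If `f` is won in the `L`-graded game with rank `α`, so is `f(Φ)`: the winning move `(θ, w)` of `f` is replaced by
`(i ↦ Ψᵢ(θ), w)`, which is again `L`-graded (linear parts multiply; degrees of substituted monomials add up,
`exists_exp_of_coeff_subst_ne_zero`) and satisfies `f(Φ)(Ψ(θ)) = f(θ)` on the nose — so the two positions have literally the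
same successors with the same propagated lattices.  No induction is needed.  Third of the three transfers (cylinder p511529,
unit p512265, coordinate change) through which the one-sided slice statement factors in the tame case. [OURS · L1 W4.3] -/
theorem gradedWonBy_subst_of_leftInverse (α : Ordinal.{0}) {m : ℕ} (L : AddSubgroup (Fin m → ℤ))
    (f : MvPowerSeries (Fin m) k) (Φ Ψ : Fin m → MvPowerSeries (Fin m) k)
    (hΦ0 : ∀ j, constantCoeff (Φ j) = 0) (hΨ0 : ∀ i, constantCoeff (Ψ i) = 0) (hΨdet : IsUnit (linMat Ψ).det)
    (hΨgr : ∀ i (e : Fin m →₀ ℕ), coeff e (Ψ i) ≠ 0 → expVec e - Pi.single i 1 ∈ L)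
    (hinv : ∀ j, subst Ψ (Φ j) = X j) :
    GradedWonBy α m L f → GradedWonBy α m L (subst Φ f) := by
  intro h
  rw [gradedWonBy_iff] at h ⊢
  obtain ⟨θ, w, hθ, hs⟩ := h
  have hθ0 : ∀ i, constantCoeff (θ i) = 0 := hθ.1.1
  have hθs : HasSubst θ := hasSubst_of_constantCoeff_zero hθ0
  have hΦs : HasSubst Φ := hasSubst_of_constantCoeff_zero hΦ0
  have hΨs : HasSubst Ψ := hasSubst_of_constantCoeff_zero hΨ0
  set θ' : Fin m → MvPowerSeries (Fin m) k := fun i => subst θ (Ψ i) with hθ'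
  have hθ'0 : ∀ i, constantCoeff (θ' i) = 0 := fun i => constantCoeff_subst_eq_zero hθs hθ0 (hΨ0 i)
  have hθ's : HasSubst θ' := hasSubst_of_constantCoeff_zero hθ'0
  have hcomp : ∀ j, subst θ' (Φ j) = θ j := by
    intro j
    rw [hθ', ← subst_comp_subst_apply hΨs hθs, hinv j, subst_X hθs]
  have hF : subst θ' (subst Φ f) = subst θ f := by
    rw [subst_comp_subst_apply hΦs hθ's]
    congr 1
    funext j
    exact hcomp j
  refine ⟨θ', w, ⟨⟨hθ'0, ?_, hθ.1.2.2⟩, ?_⟩, ?_⟩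
  · -- invertible linear part: `linMat θ' = linMat Ψ · linMat θ`
    change IsUnit (linMat θ').det
    rw [hθ', linMat_comp θ Ψ hθ0, Matrix.det_mul]
    exact hΨdet.mul hθ.1.2.1
  · -- gradedness: degrees of substituted monomials add up
    intro i e he
    obtain ⟨d, hd, hed⟩ := exists_exp_of_coeff_subst_ne_zero L hθ (Ψ i) e he
    have h2 := hΨgr i d hd
    have hsplit : expVec e - Pi.single i 1 = (expVec e - expVec d) + (expVec d - Pi.single i 1) := by abel
    rw [hsplit]
    exact L.add_mem hed h2
  · -- literally the same successors
    rintro c a g ⟨hoff, hfac, hndvd, hsing⟩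
    rw [hF] at hfac
    exact hs c a g ⟨hoff, hfac, hndvd, hsing⟩

/-- **… AND CONVERSELY** when `Φ` is itself graded with invertible linear part and `Ψ` is a two-sided inverse:
`GradedWonBy α m L (f(Φ)) ↔ GradedWonBy α m L f`. [OURS · L1 W4.3] -/
theorem gradedWonBy_subst_iff (α : Ordinal.{0}) {m : ℕ} (L : AddSubgroup (Fin m → ℤ))
    (f : MvPowerSeries (Fin m) k) (Φ Ψ : Fin m → MvPowerSeries (Fin m) k)
    (hΦ0 : ∀ j, constantCoeff (Φ j) = 0) (hΦdet : IsUnit (linMat Φ).det)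
    (hΦgr : ∀ j (e : Fin m →₀ ℕ), coeff e (Φ j) ≠ 0 → expVec e - Pi.single j 1 ∈ L)
    (hΨ0 : ∀ i, constantCoeff (Ψ i) = 0) (hΨdet : IsUnit (linMat Ψ).det)
    (hΨgr : ∀ i (e : Fin m →₀ ℕ), coeff e (Ψ i) ≠ 0 → expVec e - Pi.single i 1 ∈ L)
    (hinv : ∀ j, subst Ψ (Φ j) = X j) (hinv' : ∀ i, subst Φ (Ψ i) = X i) :
    GradedWonBy α m L (subst Φ f) ↔ GradedWonBy α m L f := by
  refine ⟨fun h => ?_, gradedWonBy_subst_of_leftInverse α L f Φ Ψ hΦ0 hΨ0 hΨdet hΨgr hinv⟩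
  have hΦs : HasSubst Φ := hasSubst_of_constantCoeff_zero hΦ0
  have hΨs : HasSubst Ψ := hasSubst_of_constantCoeff_zero hΨ0
  have hback : subst Ψ (subst Φ f) = f := by
    rw [subst_comp_subst_apply hΦs hΨs]
    have : (fun j => subst Ψ (Φ j)) = X := by funext j; exact hinv j
    rw [this, subst_self]
    rfl
  rw [← hback]
  exact gradedWonBy_subst_of_leftInverse α L (subst Φ f) Ψ Φ hΨ0 hΦ0 hΦdet hΦgr hinv' h

end GradedGame

end Summit.ResolutionOfSingularities.ResolutionOfSingularities.Theorems
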